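import Summits.ValiantsHypothesis.ValiantsHypothesis.Theorems.MonotoneRestorationOrbitRestorationQPTermCircuit
import HarnessLib

/-!
# The reduced symmetric circuit of a closed universe of normal terms: acyclicity and the circuit

Route MonotoneRestoration, crux `OrbitRestorationQP` (stmt-ValiantsHypothesis-18293) — K3 machinery, namespace
`Summit.ValiantsHypothesis.ValiantsHypothesis.Theorems.TermCircuit`.  Continuation of `…MonotoneRestorationOrbitRestorationQPTermCircuit.lean`:
the rank of a child is smaller (`rank_lt_of_mem_children`), input labels sit exactly on childless gates,
input labels are injective, and the Dawar–Wilsenach labelled circuit `TermCircuit.circuit 𝒰` (Def. 2.2) with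
output the gate of the root term.  Everything is proved. [folklore]

## References
* A. Dawar, G. Wilsenach, *Symmetric arithmetic circuits*, ToC 21 (2025), Defs. 2.2, 3.6, 3.7, §3.3
  (`Orb`, `ORB`). [DawarWilsenach2025]
* A. Dawar, G. Wilsenach, *Symmetric circuits for rank logic*, ACM ToCL 23 (2021/22), §3 (syntactic
  equivalence, reduced circuits, unique extensions). [DawarWilsenach2021]
* A. Dawar, B. Pago, T. Seppelt, *Symmetric algebraic circuits and homomorphism polynomials*,
  arXiv:2502.06740 (2025), §5. [DawarPagoSeppelt2025]
-/

noncomputable section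

open scoped Classical

-- `Summit.ValiantsHypothesis.ValiantsHypothesis.…` is the tree's single-conjunct layout (Sub = Summit).
set_option linter.dupNamespace false

namespace Summit.ValiantsHypothesis.ValiantsHypothesis.Theorems

open Literature.Computability.AlgebraicComplexity

namespace TermCircuit

open HTerm

universe u v

variable {K : Type u} {X : Type v} [CommSemiring K] (𝒰 : Universe K X)

/-! ### Ranks decrease along the wires -/

/-- The rank of the gate of a term is at most four times its size. [folklore] -/
theorem rank_gateOf_le (u : HTerm K X) : rank 𝒰 (gateOf 𝒰 u) ≤ 4 * u.size := by
  have hpos := u.size_pos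
  cases u with
  | var x => simp [gateOf, rank]
  | const c =>
    simp only [gateOf]
    split_ifs
    · simp [rank]
    · simp only [rank]; omega
  | node b l =>
    simp only [gateOf]
    split_ifs
    · simp [rank]
    · simp [rank]; omega

/-- The rank of a representative is at most `4 · size + 3`. [folklore] -/
theorem rank_rep_le (u : HTerm K X) (m : ℕ) : rank 𝒰 (rep 𝒰 u m) ≤ 4 * u.size + 3 := by
  have hpos := u.size_pos
  unfold rep
  split_ifs
  · exact (rank_gateOf_le 𝒰 u).trans (by omega)
  · simp [rank]
  · simp only [rank]; omega

/-- **Acyclicity**: children have smaller rank. [folklore] -/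
theorem rank_lt_of_mem_children {g h : Gate 𝒰} (hh : h ∈ children 𝒰 g) : rank 𝒰 h < rank 𝒰 g := by
  cases g with
  | V x => simp [children] at hh
  | C c => simp [children] at hh
  | T t =>
    obtain ⟨t, ht⟩ := t
    obtain ⟨b, l, rfl⟩ := exists_eq_node_of_mem_nodes 𝒰 ht
    cases b with
    | false =>
      rw [children_T_sum 𝒰 ⟨_, ht⟩ l rfl, List.mem_toFinset, List.mem_map] at hh
      obtain ⟨u, hu, rfl⟩ := hh
      have := size_lt_of_mem (b := false) hu
      exact (rank_rep_le 𝒰 u _).trans_lt (by simp only [rank]; omega)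
    | true =>
      rw [children_T_prod 𝒰 ⟨_, ht⟩ l rfl] at hh
      cases hsq : sqElem l with
      | some u =>
        rw [hsq] at hh
        have hul : u ∈ l := by rw [eq_of_sqElem_eq_some hsq]; simp
        have := size_lt_of_mem (b := true) hul
        simp only [Finset.mem_insert, Finset.mem_singleton] at hh
        rcases hh with rfl | rfl
        · exact (rank_gateOf_le 𝒰 u).trans_lt (by simp only [rank]; omega)
        · split_ifs <;> simp only [rank] <;> omega
      | none =>
        rw [hsq, List.mem_toFinset, List.mem_map] at hh
        obtain ⟨u, hu, rfl⟩ := hh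
        have := size_lt_of_mem (b := true) hu
        exact (rank_gateOf_le 𝒰 u).trans_lt (by simp only [rank]; omega)
  | Sc m u =>
    have hpos := u.1.size_pos
    simp only [children, Finset.mem_insert, Finset.mem_singleton] at hh
    rcases hh with rfl | rfl <;> simp [rank]
  | Pl u =>
    have hpos := u.1.size_pos
    simp only [children, Finset.mem_insert, Finset.mem_singleton] at hh
    rcases hh with rfl | rfl
    · exact (rank_gateOf_le 𝒰 u.1).trans_lt (by simp only [rank]; omega)
    · simp [rank]
  | Zr =>
    simp only [children, Finset.mem_singleton] at hh
    subst hh; simp [rank]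

/-! ### The circuit -/

/-- An input label sits exactly on the childless gates. [folklore] -/
theorem isInput_label_iff (g : Gate 𝒰) : (label 𝒰 g).IsInput ↔ children 𝒰 g = ∅ := by
  cases g with
  | V x => simp [label, children]
  | C c => simp [label, children]
  | T t =>
    obtain ⟨t, ht⟩ := t
    obtain ⟨b, l, rfl⟩ := exists_eq_node_of_mem_nodes 𝒰 ht
    cases b with
    | false =>
      rw [children_T_sum 𝒰 ⟨_, ht⟩ l rfl, label_T_sum 𝒰 ⟨_, ht⟩ l rfl]
      simp only [CircuitLabel.not_isInput_add, false_iff]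
      have hne := 𝒰.nonempty l (mem_T_of_mem_nodes 𝒰 ht)
      obtain ⟨u, hu⟩ := List.exists_mem_of_ne_nil l hne
      rw [← Ne, ← Finset.nonempty_iff_ne_empty]
      exact ⟨_, List.mem_toFinset.2 (List.mem_map.2 ⟨u, hu, rfl⟩)⟩
    | true =>
      rw [children_T_prod 𝒰 ⟨_, ht⟩ l rfl, label_T_prod 𝒰 ⟨_, ht⟩ l rfl]
      simp only [CircuitLabel.not_isInput_mul, false_iff]
      have hlen := 𝒰.binary l (mem_T_of_mem_nodes 𝒰 ht)
      obtain ⟨a, b, rfl⟩ := List.length_eq_two.1 hlen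
      rw [sqElem_pair]
      split_ifs
      · simp
      · simp
  | Sc m u => simp [label, children]
  | Pl u => simp [label, children]
  | Zr => simp [label, children]

/-- Distinct input gates have distinct labels. [folklore] -/
theorem eq_of_label_eq_of_isInput (g g' : Gate 𝒰) (hg : (label 𝒰 g).IsInput)
    (h : label 𝒰 g = label 𝒰 g') : g = g' := by
  cases g with
  | V x =>
    cases g' with
    | V x' => simp only [label, CircuitLabel.var.injEq] at h; rw [h]
    | C c' => simp [label] at h
    | T t' =>
      obtain ⟨t', ht'⟩ := t'
      obtain ⟨b, l, rfl⟩ := exists_eq_node_of_mem_nodes 𝒰 ht'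
      cases b
      · rw [label_T_sum 𝒰 ⟨_, ht'⟩ l rfl] at h; simp [label] at h
      · rw [label_T_prod 𝒰 ⟨_, ht'⟩ l rfl] at h; simp [label] at h
    | Sc m u => simp [label] at h
    | Pl u => simp [label] at h
    | Zr => simp [label] at h
  | C c =>
    cases g' with
    | V x' => simp [label] at h
    | C c' => simp only [label, CircuitLabel.const.injEq] at h; rw [Subtype.ext h]
    | T t' =>
      obtain ⟨t', ht'⟩ := t'
      obtain ⟨b, l, rfl⟩ := exists_eq_node_of_mem_nodes 𝒰 ht'
      cases b
      · rw [label_T_sum 𝒰 ⟨_, ht'⟩ l rfl] at h; simp [label] at h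
      · rw [label_T_prod 𝒰 ⟨_, ht'⟩ l rfl] at h; simp [label] at h
    | Sc m u => simp [label] at h
    | Pl u => simp [label] at h
    | Zr => simp [label] at h
  | T t =>
    obtain ⟨t, ht⟩ := t
    obtain ⟨b, l, rfl⟩ := exists_eq_node_of_mem_nodes 𝒰 ht
    cases b
    · rw [label_T_sum 𝒰 ⟨_, ht⟩ l rfl] at hg; simp at hg
    · rw [label_T_prod 𝒰 ⟨_, ht⟩ l rfl] at hg; simp at hg
  | Sc m u => simp [label] at hg
  | Pl u => simp [label] at hg
  | Zr => simp [label] at hg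

/-- **The reduced term circuit** of the universe, with output the gate of the root term.
[folklore] -/
def circuit : LabelledArithCircuit K X Unit (Gate 𝒰) where
  children := children 𝒰
  label := label 𝒰
  output := fun _ => gateOf 𝒰 𝒰.root
  wf := Subrelation.wf (fun {_ _} hh => rank_lt_of_mem_children 𝒰 hh)
    (InvImage.wf (rank 𝒰) Nat.lt_wfRel.wf)
  isInput_iff := isInput_label_iff 𝒰
  eq_of_label_eq := eq_of_label_eq_of_isInput 𝒰
  output_injective := fun a b _ => Subsingleton.elim a b

end TermCircuit

end Summit.ValiantsHypothesis.ValiantsHypothesis.Theorems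

end
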